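import Mathlib
import Summits.KontsevichZagierPeriods.Zeta5Search.PalindromicKBound
import HarnessLib

/-!
# ζ(5) search — the TERMWISE MIXED-PAIR BOUND is a THEOREM (`MixedPairTermwise`, gen-2 g9 `MixedPairs.lean`)

Cell `pub-zeta5` (HONEST FRAMING: systematic search; no irrationality claim unless certified), typer seat
generation 9.  Discharges BY NAME `MixedPairTermwise` (REPORT-gen2-g9 §11; exact check 97,844 mixed pairs): for a multipole class `x`
and a single-pole class `y` of `b` modulo a window prime `p ≤ b₀`, the mixed term of the `𝒦`-bracket satisfies
`v_p(𝒦_x(b⁺)V_y(b) − 𝒦_x(b)V_y(b⁺)) ≥ 3 + E_x + ν_y + palUnit`, `b⁺ = b + e_j`.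

PROOF.  Termwise: `v(𝒦_x(b)) ≥ 3 + E_x + palUnit` (the palindromic `𝒦`-class bound `palindromicClassKBound_holds`, typer g9, when
`palUnit = 1`; `multipoleClassKBound_holds` otherwise); `v(𝒦_x(b⁺)) ≥` the same (if the class is hit by the shift, `E_x(b⁺) ≥ E_x + 1`;
if not, its net exponents, configuration, pole count and `palUnit` are unchanged and the bound for `b⁺` applies); `v(V_y(b)) ≥ ν_y`
(`classNuBound_holds`) and `v(V_y(b⁺)) ≥ ν_y(b⁺) ≥ ν_y(b)` (`classNu_shift_ge`, or `V_y(b⁺) = 0` if the pole is gone).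
`p`-adic valuations of rationals; nothing about irrationality.
-/

noncomputable section

open Finset

namespace Summit.KontsevichZagierPeriods.Zeta5Search.ClusterValuation

open Summit.KontsevichZagierPeriods.Zeta5Search.DualSeries (InBox)
open Summit.KontsevichZagierPeriods.Zeta5Search.CasoratianValuation (InPolytope shift)
open Summit.KontsevichZagierPeriods.Zeta5Search.BigPrime (shift_zero)
open Summit.KontsevichZagierPeriods.Zeta5Search.PadicSeries

variable {p : ℕ} [hp : Fact p.Prime]

/-- **`‖𝒦_x(b)‖_p ≤ p^{−(3 + E_x + palUnit)}`** for a multipole class (the palindromic `𝒦`-class bound in norm form). -/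
theorem padicNorm_classK_le_pal (b : ℕ → ℤ) (hb : InPolytope b) (hp5 : 5 ≤ p) (hpb : (p : ℤ) ≤ b 0)
    (hwin : (b 0 + 2 : ℤ) < (p : ℤ) ^ 2) {x : ℕ} (hx : x < p) (hmulti : 2 ≤ classPoleCount b p x) :
    padicNorm p (classK b p x) ≤ (p : ℚ) ^ (-(3 + classExp b p x + palUnit b p x)) := by
  unfold palUnit
  split_ifs with h
  · obtain ⟨hpal, heven, hE4⟩ := h
    refine padicNorm_le_of_val fun hne => ?_
    have hB := palindromicClassKBound_holds b p x hb hp.out hp5 hpb hwin hx hmulti (by omega) hne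
    have hodd : Odd (((3 : ℕ) : ℤ) + classExp b p x) := by
      obtain ⟨k, hk⟩ := heven
      exact ⟨k + 1, by push_cast; omega⟩
    unfold classBound at hB
    rw [if_pos hmulti, if_pos ⟨hpal, hodd⟩] at hB
    push_cast at hB ⊢
    linarith
  · rw [add_zero]
    exact padicNorm_classK_le_multi b hb hp5 hwin hx (by omega)

omit hp in
/-- A class not hit by the shift (`E_x(b⁺) = E_x(b)`) keeps all its net exponents. -/
theorem netExp_shift_eq_of_classExp_eq (b : ℕ → ℤ) {j : ℕ} (hb : InBox b) (hj1 : 1 ≤ j) {x : ℕ}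
    (hE : classExp (shift b j) p x = classExp b p x) : ∀ s ∈ classSet b p x, netExp (shift b j) s = netExp b s := by
  have hc : (if ¬ (2 : ℤ) ∣ shift b j 0 ∧ CentreIn (shift b j) p x then (1 : ℤ) else 0) =
      (if ¬ (2 : ℤ) ∣ b 0 ∧ CentreIn b p x then (1 : ℤ) else 0) := by
    by_cases h : ¬ (2 : ℤ) ∣ b 0 ∧ CentreIn b p x
    · rw [if_pos h, if_pos (by rw [shift_zero b hj1, centreIn_shift b hj1]; exact h)]
    · rw [if_neg h, if_neg (by rw [shift_zero b hj1, centreIn_shift b hj1]; exact h)]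
  have hsum : ∑ s ∈ classSet b p x, (netExp (shift b j) s - netExp b s) = 0 := by
    have h := hE
    unfold classExp at h
    rw [classSet_shift b hj1, hc] at h
    rw [sum_sub_distrib]
    linarith
  have hnn : ∀ s ∈ classSet b p x, 0 ≤ netExp (shift b j) s - netExp b s :=
    fun s _ => by linarith [netExp_shift_ge b hb hj1 s]
  intro s hs
  have := (sum_eq_zero_iff_of_nonneg hnn).1 hsum s hs
  linarith

/-- **`‖𝒦_x(b⁺)‖_p ≤ p^{−(3 + E_x(b) + palUnit(b))}`** for a multipole class `x` of `b`. -/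
theorem padicNorm_classK_shift_le_pal (b : ℕ → ℤ) {j : ℕ} (hb : InPolytope b) (hj1 : 1 ≤ j) (hb' : InPolytope (shift b j))
    (hp5 : 5 ≤ p) (hpb : (p : ℤ) ≤ b 0) (hwin : (b 0 + 2 : ℤ) < (p : ℤ) ^ 2) {x : ℕ} (hx : x < p)
    (hmulti : 2 ≤ classPoleCount b p x) :
    padicNorm p (classK (shift b j) p x) ≤ (p : ℚ) ^ (-(3 + classExp b p x + palUnit b p x)) := by
  have hwin' : (shift b j 0 + 2 : ℤ) < (p : ℤ) ^ 2 := by rwa [shift_zero b hj1]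
  have hpb' : (p : ℤ) ≤ shift b j 0 := by rwa [shift_zero b hj1]
  have hEge := classExp_shift_ge b hb.1 hj1 p x
  rcases Nat.eq_zero_or_pos (classPoleCount (shift b j) p x) with h0 | hpos
  · rw [classK_eq_zero_of_noPole (shift b j) hb' h0, padicNorm.zero]; exact zpow_p_nonneg _
  by_cases hEeq : classExp (shift b j) p x = classExp b p x
  · -- the class is not hit: same net exponents, configuration, pole count and `palUnit`
    have hnet := netExp_shift_eq_of_classExp_eq b hb.1 hj1 hEeq
    have hfilt : (classSet b p x).filter (fun s => netExp (shift b j) s ≠ 0) =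
        (classSet b p x).filter (fun s => netExp b s ≠ 0) :=
      filter_congr fun s hs => by rw [hnet s hs]
    have hcount : classPoleCount (shift b j) p x = classPoleCount b p x := by
      unfold classPoleCount
      rw [classSet_shift b hj1]
      exact congrArg card (filter_congr fun s hs => by rw [hnet s hs])
    have hconf : classConfig (shift b j) p x = classConfig b p x := by
      unfold classConfig
      rw [classSet_shift b hj1, shift_zero b hj1, hfilt]
      congr 1
      · exact image_congr fun s hs => by
          have hs' : s ∈ classSet b p x := (mem_filter.1 (mem_coe.1 hs)).1
          simp only [hnet s hs']
      · by_cases h : ¬ (2 : ℤ) ∣ b 0 ∧ CentreIn b p x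
        · rw [if_pos h, if_pos (by rw [centreIn_shift b hj1]; exact h)]
        · rw [if_neg h, if_neg (by rw [centreIn_shift b hj1]; exact h)]
    have hpu : palUnit (shift b j) p x = palUnit b p x := by
      unfold palUnit; rw [hconf, hEeq]
    have h := padicNorm_classK_le_pal (shift b j) hb' hp5 hpb' hwin' hx (by rw [hcount]; exact hmulti)
    rwa [hEeq, hpu] at h
  · -- the class is hit: `E_x(b⁺) ≥ E_x(b) + 1 ≥` what the unit asks
    have hpu1 : palUnit b p x ≤ 1 := by unfold palUnit; split_ifs <;> norm_num
    refine (padicNorm_classK_le_multi (shift b j) hb' hp5 hwin' hx hpos).trans (zpow_le_zpow_right₀ one_le_p ?_)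
    omega

/-- **`‖V_y(b⁺)‖_p ≤ p^{−ν_y(b)}`** for a pole class `y` of `b`. -/
theorem padicNorm_classV_shift_le (b : ℕ → ℤ) {j : ℕ} (hb : InPolytope b) (hj1 : 1 ≤ j) (hb' : InPolytope (shift b j))
    (hp5 : 5 ≤ p) (hwin : (b 0 + 2 : ℤ) < (p : ℤ) ^ 2) {y : ℕ} (hy : y < p) :
    padicNorm p (classV (shift b j) p y) ≤ (p : ℚ) ^ (-classNu b p y) := by
  have hwin' : (shift b j 0 + 2 : ℤ) < (p : ℤ) ^ 2 := by rwa [shift_zero b hj1]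
  rcases Nat.eq_zero_or_pos (classPoleCount (shift b j) p y) with h0 | hpos
  · rw [classV_eq_zero_of_noPole (shift b j) hb' h0, padicNorm.zero]; exact zpow_p_nonneg _
  · exact (padicNorm_classV_le (shift b j) hb' hp5 hwin' hy hpos).trans
      (zpow_le_zpow_right₀ one_le_p (by linarith [classNu_shift_ge b hb.1 hj1 hpos]))

/-- **`MixedPairTermwise` is a theorem.** -/
theorem mixedPairTermwise_holds : MixedPairTermwise := by
  intro b j p x y hb hj1 _hj7 hb' hprime hp5 hpb hwin hx hy hmulti hone hne
  haveI : Fact p.Prime := ⟨hprime⟩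
  have hK := padicNorm_classK_le_pal b hb hp5 hpb hwin hx hmulti
  have hK' := padicNorm_classK_shift_le_pal b hb hj1 hb' hp5 hpb hwin hx hmulti
  have hV := padicNorm_classV_le b hb hp5 hwin hy (by omega)
  have hV' := padicNorm_classV_shift_le b hb hj1 hb' hp5 hwin hy
  apply val_ge_of_padicNorm_le hne
  have e : -(3 + classExp b p x + classNu b p y + palUnit b p x) =
      -(3 + classExp b p x + palUnit b p x) + -classNu b p y := by ring
  rw [e]
  exact (padicNorm.sub (p := p)).trans (max_le (padicNorm_mul_le hK' hV) (padicNorm_mul_le hK hV'))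

end Summit.KontsevichZagierPeriods.Zeta5Search.ClusterValuation

end
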